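import Summits.BirchSwinnertonDyer.BirchSwinnertonDyer.Theorems.PrintX11aLowerHalfFiveOfChildren
import HarnessLib

/-!
# Crux `X11aLowerHalf` (item stmt-BirchSwinnertonDyer-19064) and the NEW by-name item `X11aLowerHalfAtThree`
# (item stmt-BirchSwinnertonDyer-23178, routes `ClassRecordThree` ∕ `KolyvaginRoadThree`, planner bsd-stepL g42 RULING 73 (d),
# 2026-08-28T19:11Z): the kernel glue between the two, keyed on line «birth» r17's registered children
# (lead bsd-line-x11a-p1 gen 9; `--supports stmt-BirchSwinnertonDyer-19064` helper)

HONEST FRAMING.  Composition ∕ bookkeeping theorems only; no definition, no named fact minted, no `sorry`.  Every theorem is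
CONDITIONAL on its displayed binders and closes nothing by itself.  The two research statements of line r17 — Mazur's cyclotomic
main conjecture at the deep X11a pairs with `p ≥ 5` (`hMC5`) and at the très-ramifié deep X11a pairs with `p = 3` (`hMC3`) — stay OPEN
and DISPLAYED.  No summit statement is proved; BSD is proved for no curve and no class.

WHY THIS FILE.  Item 23178 `X11aLowerHalfAtThree` := `∀ V, ClassX11a V 3 → Typed.MissingLowerBoundAt V 3` is crux 19064 READ AT `p = 3`
(the registered stub `stub_x11aLowerHalfAtThree` of crux 19109's line inert r20, filed as an item so that «the two halves of 19064 live
where they are consumed»: bsd-stepL's crux 19715 consumes only the `p ≥ 5` restriction, er5-p1 g4 p657101; cruxes 19109 ∕ 21420 consume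
only `p = 3`).  Its TEXT fixes the literal prime `3`, whereas every `p = 3` binder of the x11a cell's files is in the guarded shape
`∀ W p, ClassX11a W p → p = 3 → ¬ X11a.ShaAnUnit W p → MissingLowerBoundAt W p` (unit pairs free).  This file supplies, once:
* §1 the two shapes are EQUIVALENT (pure logic: `subst`, unit pairs via `x11a_missingLowerBoundAt_of_shaAnUnit`), and the item's text is the
  restriction of crux L (`lowerAtThree_of_x11aLowerHalf`);
* §2 **item 23178's TEXT from line r17's `p = 3` children** — the shared nine `h9`, the two-fact child `h2L` (Kato–Wuthrich A32 ∧ GZK), the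
  three partner facts `hQ3`, and `hMC3` — through p646859's `p = 3` road `ThreePartner.lowerThreeDeep_of_partnerFF_of_mazurTR_of_facts` (finite
  flat: Hesse-pencil partner + partner road; très ramifié: Mazur's statement at the pair through the five-fact door):
  `Birth.lowerAtThree_of_children_r17_three h9 h2L hQ3 hMC3`.  The BY-NAME wrappers for 23178's two route decls
  (`Theses.ClassRecordThree.X11aLowerHalfAtThree`, `Theses.KolyvaginRoadThree.X11aLowerHalfAtThree`; both `:=` this text) live in the companion
  file `Theorems/PrintX11aLowerHalfAtThreeByName.lean`, so that THIS file's cone stays inside the x11a cell (the two route files are edited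
  hourly by their pens);
* §3 **crux L BY NAME ⟸ item 23178's text + the `p ≥ 5` restriction** (fact-free; EXACTNESS `x11aLowerHalf_iff_lowerAtThree_and_lowerX11aFive`:
  the split is lossless), and the composition of a line whose `p = 3` child IS item 23178: `x11aLowerHalf_of_lowerAtThree_of_children_r18
  hA h9 hGZK hMC5` — the shared nine (only modularity, Stein–Wuthrich 6.1 ×2 and Greenberg–Stevens are consumed), GZK (= route `PrintX11a`'s
  input item `RankEqAnalyticRankLeOne` by text), and `hMC5` through p657610's `lowerX11aFive_of_mazurMCAtDeepFive_of_fiveFacts`; + the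
  `ErratumRoadFive` spellings.
READING.  With 23178 filed, crux L = (item 23178) ∧ (its `p ≥ 5` restriction), and the `p ≥ 5` restriction = ONE research statement (Mazur's
main conjecture at the deep X11a pairs with `p ≥ 5`, printed only under (ram): Skinner 2016 Thm. A) + five printed facts.  Nothing here is new
mathematics; BSD is not proved by any of this.

References: [Miller2011LMS] Def. 1.1 (arXiv:1010.2431 p. 3); [Skinner2016PacificMC] Thm. A (shape; printed under (irr)+(ram));
[MazurTateTeitelbaum1986Invent] §I.14 (shape); [SteinWuthrich2013] Thm. 6.1; [EmertonPollackWeston2006] Thm. 1, Cor. 5.1.4;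
[YanZhu2024MainConjNonCM] Thm. 4.9; [Wuthrich2014] Thm. 3, Lemma 20; [Kato2004Asterisque] Thm. 12.4, §17.13; [Mazur1978] Cor. 4.1;
[Fisher2012Hessian] Thm. 13.2; cell files `Cruxes/X11aLowerHalf/Lines/birth.lean` (r17), `LEAD-g8-VERDICT.md`; tree
`Theorems/PrintX11aLowerHalfFiveOfChildren.lean` (p657610), `Theorems/PrintX11aLowerHalfThreeMazurCore.lean` (p646859).
-/

set_option autoImplicit false
set_option linter.dupNamespace false -- the directory name repeats the summit name (sibling precedent)

noncomputable section

open scoped Classical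

open WeierstrassCurve
  Literature.NumberTheory.EllipticCurves
  Literature.NumberTheory.EllipticCurves.ModularForms
  Literature.NumberTheory.EllipticCurves.Rank1Residual
  Literature.NumberTheory.EllipticCurves.Rank1Residual.Typed
  Literature.NumberTheory.EllipticCurves.Wuthrich2014
  Literature.NumberTheory.EllipticCurves.SteinWuthrich2013
  Literature.NumberTheory.EllipticCurves.Greenberg1999
  Literature.NumberTheory.EllipticCurves.Kato2004
  Literature.NumberTheory.EllipticCurves.EmertonPollackWeston2006
  Summit.BirchSwinnertonDyer.Rank1Residual
  Summit.BirchSwinnertonDyer.Rank1Residual.X11a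

namespace Summit.BirchSwinnertonDyer.BirchSwinnertonDyer.Theorems.Birth

/-! ### §1 The two shapes of «crux L at `p = 3`» are equivalent (pure logic) -/

/-- **Item 23178's text ⟹ the cell's guarded `p = 3` binder**: from `∀ V, ClassX11a V 3 → MissingLowerBoundAt V 3` (literal prime)
to `∀ W p, ClassX11a W p → p = 3 → ¬ X11a.ShaAnUnit W p → MissingLowerBoundAt W p` (`subst`; the `Fact p.Prime` instances agree by proof
irrelevance; the unit guard is simply not used).  Pure logic; closes nothing. [cite: Miller2011LMS, Def. 1.1 (arXiv:1010.2431 p. 3)] -/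
theorem threeDeep_of_lowerAtThree
    (hA : ∀ (V : WeierstrassCurve ℚ) [V.IsElliptic] [V.IsGloballyMinimal], ClassX11a V 3 → MissingLowerBoundAt V 3) :
    ∀ (W : WeierstrassCurve ℚ) [W.IsElliptic] [W.IsGloballyMinimal] (p : ℕ) [Fact p.Prime],
      ClassX11a W p → p = 3 → ¬ X11a.ShaAnUnit W p → MissingLowerBoundAt W p := by
  intro W _ _ p _ hX hp3 _
  subst hp3
  exact hA W hX

/-- **The cell's guarded `p = 3` binder ⟹ item 23178's text**: unit pairs (`#Ш_an` a `3`-adic unit) are free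
(`x11a_missingLowerBoundAt_of_shaAnUnit`: `0 ≤ ord₃ #Ш`), deep pairs by the binder at `p := 3`.  Pure logic; closes nothing.
[cite: Miller2011LMS, Def. 1.1 (arXiv:1010.2431 p. 3)] -/
theorem lowerAtThree_of_threeDeep
    (h3 : ∀ (W : WeierstrassCurve ℚ) [W.IsElliptic] [W.IsGloballyMinimal] (p : ℕ) [Fact p.Prime],
      ClassX11a W p → p = 3 → ¬ X11a.ShaAnUnit W p → MissingLowerBoundAt W p) :
    ∀ (V : WeierstrassCurve ℚ) [V.IsElliptic] [V.IsGloballyMinimal], ClassX11a V 3 → MissingLowerBoundAt V 3 := by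
  intro V _ _ hX
  by_cases hu : X11a.ShaAnUnit V 3
  · exact x11a_missingLowerBoundAt_of_shaAnUnit hu
  · exact h3 V 3 hX rfl hu

/-- **EXACTNESS of the reshaping at `p = 3`**: item 23178's text ⟺ the cell's guarded `p = 3` binder (§1 both ways).  Pure logic; closes
nothing. [cite: Miller2011LMS, Def. 1.1 (arXiv:1010.2431 p. 3)] -/
theorem lowerAtThree_iff_threeDeep :
    (∀ (V : WeierstrassCurve ℚ) [V.IsElliptic] [V.IsGloballyMinimal], ClassX11a V 3 → MissingLowerBoundAt V 3) ↔
      ∀ (W : WeierstrassCurve ℚ) [W.IsElliptic] [W.IsGloballyMinimal] (p : ℕ) [Fact p.Prime],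
        ClassX11a W p → p = 3 → ¬ X11a.ShaAnUnit W p → MissingLowerBoundAt W p :=
  ⟨threeDeep_of_lowerAtThree, lowerAtThree_of_threeDeep⟩

/-- **Item 23178's text is the restriction of crux L** (`Theses.PrintX11a.X11aLowerHalf`, = `Theses.ErratumRoadFive.X11aLowerHalf` by
`Iff.rfl`) to the prime `3`.  Bookkeeping; closes nothing. [cite: Miller2011LMS, Def. 1.1 (arXiv:1010.2431 p. 3)] -/
theorem lowerAtThree_of_x11aLowerHalf (h : Summit.BirchSwinnertonDyer.BirchSwinnertonDyer.Theses.PrintX11a.X11aLowerHalf) :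
    ∀ (V : WeierstrassCurve ℚ) [V.IsElliptic] [V.IsGloballyMinimal], ClassX11a V 3 → MissingLowerBoundAt V 3 :=
  fun V _ _ hX ↦ h V 3 hX

/-! ### §2 Item 23178's text from line r17's `p = 3` children -/

/-- **Item 23178's TEXT `∀ V, ClassX11a V 3 → MissingLowerBoundAt V 3` from line r17's `p = 3` CHILDREN** (binders byte-equal to the
registered stub texts of `Cruxes/X11aLowerHalf/Lines/birth.lean` r17): the shared nine `h9` (= `stub_nineFactsOddGS`, crux U3's text; all nine
are consumed at `3`), the two-fact child `h2L` (= `stub_katoGZKFactsLower`: Kato–Wuthrich A32 ∧ GZK), the three partner facts `hQ3`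
(= `stub_threePartnerFactsLower`: EPW Cor. 5.1.4, Yan–Zhu Thm. 4.9, EPW Thm. 1 alg) and `hMC3` (= `stub_mazurMCAtTresRamifieThree`: Mazur's
cyclotomic main conjecture at every très-ramifié deep X11a pair at `3`; OPEN — printed only under (ram), Skinner 2016 Thm. A).  Body =
p646859's `ThreePartner.lowerThreeDeep_of_partnerFF_of_mazurTR_of_facts` (finite flat at `3`: the Hesse-pencil partner, fact-free, + the
partner road with THEOREM B inside; très ramifié: `hMC3` at the pair through the five-fact door; unit pairs free), reshaped to the literal
prime by §1.  The by-name PLANNER TURNKEY for 23178 is the companion file's `Birth.x11aLowerHalfAtThree_of_children_r17_three` (:= this).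
CONDITIONAL; closes nothing; BSD is not proved.
[cite: MazurTateTeitelbaum1986Invent, §I.14 (shape only)] [cite: Skinner2016PacificMC, Thm. A (shape only; printed under (ram))]
[cite: EmertonPollackWeston2006, Cor. 5.1.4, Thm. 1] [cite: YanZhu2024MainConjNonCM, Thm. 4.9] [cite: Fisher2012Hessian, Thm. 13.2 (n = 3)]
[cite: Wuthrich2014, Thm. 3 (p. 382), Lemma 20 (p. 400)] [cite: Kato2004Asterisque, Thm. 12.4 (p. 221), §17.13 (pp. 279–280)]
[cite: SteinWuthrich2013, Thm. 6.1 (p. 20)] [cite: Mazur1978, Cor. 4.1] [cite: Miller2011LMS, Def. 1.1 (arXiv:1010.2431 p. 3)] -/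
theorem lowerAtThree_of_children_r17_three
    (h9 : thm61_splitMultiplicative ∧ thm61_nonsplitMultiplicative ∧
      (∀ (W : WeierstrassCurve ℚ) [W.IsElliptic] [W.IsGloballyMinimal] (p : ℕ) [Fact p.Prime],
        p ≠ 2 → greenberg_stevens (W := W) (p := p)) ∧
      Kato2004.thm12_4 ∧ exists_isNewformOf ∧
      Kato2004.exists_multDivisibilityInputs_nonsplit_contra ∧
      Kato2004.exists_multDivisibilityInputs_split_contra ∧
      Kato2004.exists_multDivisibilityInputs_fine_contra ∧ mazur_not_dvd_maninConstant_of_odd)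
    (h2L : kato_charIdeal_dvd_multiplicative_of_surjective ∧ rank_eq_analyticRank_of_analyticRank_le_one)
    (hQ3 : cor514_transfer_of_goodOrdinary_odd ∧ YanZhu2026.thm49_charIdeal_eq_padicLFunction ∧
      thm1_muAlg_transfer_goodOrdinary_of_mult_odd)
    (hMC3 : ∀ (W : WeierstrassCurve ℚ) [W.IsElliptic] [W.IsGloballyMinimal] (p : ℕ) [Fact p.Prime],
      ClassX11a W p → p = 3 → ¬ X11a.ShaAnUnit W p → ¬ p ∣ padicValInt p W.minimalDiscriminantInt →
      X2.MazurMainConjectureAt W p) :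
    ∀ (V : WeierstrassCurve ℚ) [V.IsElliptic] [V.IsGloballyMinimal], ClassX11a V 3 → MissingLowerBoundAt V 3 := by
  obtain ⟨hJs, hJn, hGS, h12, hNf, hns', hsp', hfine', hMz⟩ := h9
  obtain ⟨hKato, hGZK⟩ := h2L
  obtain ⟨hEPW, hYZ, hTa⟩ := hQ3
  exact lowerAtThree_of_threeDeep
    (ThreePartner.lowerThreeDeep_of_partnerFF_of_mazurTR_of_facts hNf hKato h12 hns' hsp' hfine' hMz hJs hJn hGZK hGS
      hEPW hYZ hTa hMC3)

/-! ### §3 Crux L BY NAME from item 23178's text and the `p ≥ 5` side -/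

/-- **Crux `X11aLowerHalf` BY NAME ⟸ item 23178's text `hA` + the `p ≥ 5` restriction `h5`** — fact-free (§1 + p657610's
`x11aLowerHalf_of_lowerX11aFive_of_threeDeep`: unit pairs free, an X11a prime is odd so `p = 3 ∨ 5 ≤ p`).  Pure logic; CONDITIONAL on both
halves (each OPEN class-wide through its research statement); closes nothing; BSD is not proved.
[cite: Miller2011LMS, Def. 1.1 (arXiv:1010.2431 p. 3)] -/
theorem x11aLowerHalf_of_lowerAtThree_of_lowerX11aFive
    (hA : ∀ (V : WeierstrassCurve ℚ) [V.IsElliptic] [V.IsGloballyMinimal], ClassX11a V 3 → MissingLowerBoundAt V 3)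
    (h5 : ∀ (W : WeierstrassCurve ℚ) [W.IsElliptic] [W.IsGloballyMinimal] (p : ℕ) [Fact p.Prime],
      ClassX11a W p → 5 ≤ p → MissingLowerBoundAt W p) :
    Summit.BirchSwinnertonDyer.BirchSwinnertonDyer.Theses.PrintX11a.X11aLowerHalf :=
  x11aLowerHalf_of_lowerX11aFive_of_threeDeep h5 (threeDeep_of_lowerAtThree hA)

/-- The `ErratumRoadFive` spelling of the fact-free recomposition (one statement under two route names, `Iff.rfl`).  Pure logic; closes
nothing. [cite: Miller2011LMS, Def. 1.1 (arXiv:1010.2431 p. 3)] -/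
theorem x11aLowerHalf_erratumRoadFive_of_lowerAtThree_of_lowerX11aFive
    (hA : ∀ (V : WeierstrassCurve ℚ) [V.IsElliptic] [V.IsGloballyMinimal], ClassX11a V 3 → MissingLowerBoundAt V 3)
    (h5 : ∀ (W : WeierstrassCurve ℚ) [W.IsElliptic] [W.IsGloballyMinimal] (p : ℕ) [Fact p.Prime],
      ClassX11a W p → 5 ≤ p → MissingLowerBoundAt W p) :
    Summit.BirchSwinnertonDyer.BirchSwinnertonDyer.Theses.ErratumRoadFive.X11aLowerHalf :=
  x11aLowerHalf_of_lowerAtThree_of_lowerX11aFive hA h5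

/-- **EXACTNESS of the split of crux L at the item boundary**: `X11aLowerHalf ↔ (item 23178's text) ∧ (its `p ≥ 5` restriction)` — the
split is lossless (the converse directions are restrictions).  Pure logic; closes nothing. [cite: Miller2011LMS, Def. 1.1 (arXiv:1010.2431 p. 3)] -/
theorem x11aLowerHalf_iff_lowerAtThree_and_lowerX11aFive :
    Summit.BirchSwinnertonDyer.BirchSwinnertonDyer.Theses.PrintX11a.X11aLowerHalf ↔
      (∀ (V : WeierstrassCurve ℚ) [V.IsElliptic] [V.IsGloballyMinimal], ClassX11a V 3 → MissingLowerBoundAt V 3) ∧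
      ∀ (W : WeierstrassCurve ℚ) [W.IsElliptic] [W.IsGloballyMinimal] (p : ℕ) [Fact p.Prime],
        ClassX11a W p → 5 ≤ p → MissingLowerBoundAt W p :=
  ⟨fun h ↦ ⟨lowerAtThree_of_x11aLowerHalf h, fun W _ _ p _ hX _ ↦ h W p hX⟩,
    fun h ↦ x11aLowerHalf_of_lowerAtThree_of_lowerX11aFive h.1 h.2⟩

/-- **Crux `X11aLowerHalf` BY NAME from item 23178's text + ONE research statement + FIVE printed facts** (minimal display): `hA` (item
23178), modularity `hNf`, Stein–Wuthrich 6.1 split ∕ non-split `hJs` ∕ `hJn`, GZK `hGZK`, Greenberg–Stevens at odd primes `hGS`, and `hMC5`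
(Mazur's cyclotomic main conjecture at every deep X11a pair with `p ≥ 5`, both images — OPEN, printed only under (ram)); `p ≥ 5` through
p657610's `lowerX11aFive_of_mazurMCAtDeepFive_of_fiveFacts` (p646859's five-fact door at the pair).  CONDITIONAL; closes nothing; BSD is not
proved. [cite: Skinner2016PacificMC, Thm. A (shape only; printed under (ram))] [cite: SteinWuthrich2013, Thm. 6.1 (p. 20)]
[cite: MazurTateTeitelbaum1986Invent, §I.14 (shape only)] [cite: Miller2011LMS, Def. 1.1 (arXiv:1010.2431 p. 3)] -/
theorem x11aLowerHalf_of_lowerAtThree_of_mazurMCAtDeepFive_of_fiveFacts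
    (hA : ∀ (V : WeierstrassCurve ℚ) [V.IsElliptic] [V.IsGloballyMinimal], ClassX11a V 3 → MissingLowerBoundAt V 3)
    (hNf : exists_isNewformOf) (hJs : thm61_splitMultiplicative) (hJn : thm61_nonsplitMultiplicative)
    (hGZK : rank_eq_analyticRank_of_analyticRank_le_one)
    (hGS : ∀ (W : WeierstrassCurve ℚ) [W.IsElliptic] [W.IsGloballyMinimal] (p : ℕ) [Fact p.Prime],
      p ≠ 2 → greenberg_stevens (W := W) (p := p))
    (hMC5 : ∀ (W : WeierstrassCurve ℚ) [W.IsElliptic] [W.IsGloballyMinimal] (p : ℕ) [Fact p.Prime],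
      ClassX11a W p → 5 ≤ p → ¬ X11a.ShaAnUnit W p → X2.MazurMainConjectureAt W p) :
    Summit.BirchSwinnertonDyer.BirchSwinnertonDyer.Theses.PrintX11a.X11aLowerHalf :=
  x11aLowerHalf_of_lowerAtThree_of_lowerX11aFive hA
    (lowerX11aFive_of_mazurMCAtDeepFive_of_fiveFacts hNf hJs hJn hGZK hGS hMC5)

/-- **COMPOSITION of line «birth» r18 (candidate; the `p = 3` child IS item 23178)**: crux `X11aLowerHalf` BY NAME from FOUR children —
`hA` = item 23178's text (`stub_x11aLowerHalfAtThree`), `h9` = the shared nine (`stub_nineFactsOddGS`, crux U3's text; only modularity,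
Stein–Wuthrich 6.1 ×2 and Greenberg–Stevens are consumed here), `hGZK` = Gross–Zagier–Kolyvagin (`rank = r_an ≤ 1`, `Ш` finite; = route
`PrintX11a`'s input item `RankEqAnalyticRankLeOne` by text), `hMC5` = `stub_mazurMCAtDeepFive` (OPEN).  The three partner facts, Kato–Wuthrich
A32 and `hMC3` of r17 are NOT binders: they serve item 23178 (§2).  CONDITIONAL; closes nothing; BSD is not proved.
[cite: Skinner2016PacificMC, Thm. A (shape only; printed under (ram))] [cite: SteinWuthrich2013, Thm. 6.1 (p. 20)]
[cite: Kato2004Asterisque, Thm. 12.4 (p. 221), §17.13 (pp. 279–280)] [cite: Mazur1978, Cor. 4.1]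
[cite: MazurTateTeitelbaum1986Invent, §I.14 (shape only)] [cite: Miller2011LMS, Def. 1.1 (arXiv:1010.2431 p. 3)] -/
theorem x11aLowerHalf_of_lowerAtThree_of_children_r18
    (hA : ∀ (V : WeierstrassCurve ℚ) [V.IsElliptic] [V.IsGloballyMinimal], ClassX11a V 3 → MissingLowerBoundAt V 3)
    (h9 : thm61_splitMultiplicative ∧ thm61_nonsplitMultiplicative ∧
      (∀ (W : WeierstrassCurve ℚ) [W.IsElliptic] [W.IsGloballyMinimal] (p : ℕ) [Fact p.Prime],
        p ≠ 2 → greenberg_stevens (W := W) (p := p)) ∧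
      Kato2004.thm12_4 ∧ exists_isNewformOf ∧
      Kato2004.exists_multDivisibilityInputs_nonsplit_contra ∧
      Kato2004.exists_multDivisibilityInputs_split_contra ∧
      Kato2004.exists_multDivisibilityInputs_fine_contra ∧ mazur_not_dvd_maninConstant_of_odd)
    (hGZK : rank_eq_analyticRank_of_analyticRank_le_one)
    (hMC5 : ∀ (W : WeierstrassCurve ℚ) [W.IsElliptic] [W.IsGloballyMinimal] (p : ℕ) [Fact p.Prime],
      ClassX11a W p → 5 ≤ p → ¬ X11a.ShaAnUnit W p → X2.MazurMainConjectureAt W p) :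
    Summit.BirchSwinnertonDyer.BirchSwinnertonDyer.Theses.PrintX11a.X11aLowerHalf :=
  x11aLowerHalf_of_lowerAtThree_of_mazurMCAtDeepFive_of_fiveFacts hA h9.2.2.2.2.1 h9.1 h9.2.1 hGZK h9.2.2.1 hMC5

/-- The `ErratumRoadFive` spelling of the r18 composition (one statement under two route names, `Iff.rfl`).  CONDITIONAL; closes
nothing; BSD is not proved. [cite: Miller2011LMS, Def. 1.1 (arXiv:1010.2431 p. 3)] [cite: MazurTateTeitelbaum1986Invent, §I.14 (shape only)] -/
theorem x11aLowerHalf_erratumRoadFive_of_lowerAtThree_of_children_r18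
    (hA : ∀ (V : WeierstrassCurve ℚ) [V.IsElliptic] [V.IsGloballyMinimal], ClassX11a V 3 → MissingLowerBoundAt V 3)
    (h9 : thm61_splitMultiplicative ∧ thm61_nonsplitMultiplicative ∧
      (∀ (W : WeierstrassCurve ℚ) [W.IsElliptic] [W.IsGloballyMinimal] (p : ℕ) [Fact p.Prime],
        p ≠ 2 → greenberg_stevens (W := W) (p := p)) ∧
      Kato2004.thm12_4 ∧ exists_isNewformOf ∧
      Kato2004.exists_multDivisibilityInputs_nonsplit_contra ∧
      Kato2004.exists_multDivisibilityInputs_split_contra ∧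
      Kato2004.exists_multDivisibilityInputs_fine_contra ∧ mazur_not_dvd_maninConstant_of_odd)
    (hGZK : rank_eq_analyticRank_of_analyticRank_le_one)
    (hMC5 : ∀ (W : WeierstrassCurve ℚ) [W.IsElliptic] [W.IsGloballyMinimal] (p : ℕ) [Fact p.Prime],
      ClassX11a W p → 5 ≤ p → ¬ X11a.ShaAnUnit W p → X2.MazurMainConjectureAt W p) :
    Summit.BirchSwinnertonDyer.BirchSwinnertonDyer.Theses.ErratumRoadFive.X11aLowerHalf :=
  x11aLowerHalf_of_lowerAtThree_of_children_r18 hA h9 hGZK hMC5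

/-- **Crux L BY NAME from item 23178's text + line r17's THREE `p ≥ 5` children** (the shared nine `h9`, the two-fact child `h2L` — only
GZK is consumed —, `hMC5`): the composition if the lead keeps r17's `stub_katoGZKFactsLower` as the GZK carrier (`p ≥ 5` through p657610's
`lowerX11aFive_of_children_r17_three`).  CONDITIONAL; closes nothing; BSD is not proved.
[cite: Skinner2016PacificMC, Thm. A (shape only; printed under (ram))] [cite: Wuthrich2014, Thm. 3 (p. 382)]
[cite: Miller2011LMS, Def. 1.1 (arXiv:1010.2431 p. 3)] -/
theorem x11aLowerHalf_of_lowerAtThree_of_children_r17_three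
    (hA : ∀ (V : WeierstrassCurve ℚ) [V.IsElliptic] [V.IsGloballyMinimal], ClassX11a V 3 → MissingLowerBoundAt V 3)
    (h9 : thm61_splitMultiplicative ∧ thm61_nonsplitMultiplicative ∧
      (∀ (W : WeierstrassCurve ℚ) [W.IsElliptic] [W.IsGloballyMinimal] (p : ℕ) [Fact p.Prime],
        p ≠ 2 → greenberg_stevens (W := W) (p := p)) ∧
      Kato2004.thm12_4 ∧ exists_isNewformOf ∧
      Kato2004.exists_multDivisibilityInputs_nonsplit_contra ∧
      Kato2004.exists_multDivisibilityInputs_split_contra ∧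
      Kato2004.exists_multDivisibilityInputs_fine_contra ∧ mazur_not_dvd_maninConstant_of_odd)
    (h2L : kato_charIdeal_dvd_multiplicative_of_surjective ∧ rank_eq_analyticRank_of_analyticRank_le_one)
    (hMC5 : ∀ (W : WeierstrassCurve ℚ) [W.IsElliptic] [W.IsGloballyMinimal] (p : ℕ) [Fact p.Prime],
      ClassX11a W p → 5 ≤ p → ¬ X11a.ShaAnUnit W p → X2.MazurMainConjectureAt W p) :
    Summit.BirchSwinnertonDyer.BirchSwinnertonDyer.Theses.PrintX11a.X11aLowerHalf :=
  x11aLowerHalf_of_lowerAtThree_of_lowerX11aFive hA (lowerX11aFive_of_children_r17_three h9 h2L hMC5)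

end Summit.BirchSwinnertonDyer.BirchSwinnertonDyer.Theorems.Birth

end
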